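import Summits.Ventures.QEC.Census.RankCert
import HarnessLib

/-!
# CSS census rows in the kernel (CalibCSSN07): exact `[[n, k, d]]`, `d^X`, `d^Z` for the calibCSS cells n = 7

LADDER-QEC (venture cell `qec`), CENSUS-PREREG C.2 («all CSS codes from classical pairs `C₂^⊥ ⊆ C₁` … compared cell by
cell»; companion table census/search-5/css-n12/CSS-CALIB.tsv, qec-search-5: best CSS distance per cell `(n, k)`,
`n ≤ 12`, every instance certA ∧ certB ∧ ref-1 = tier COMPUTED in census/TABLE.tsv, family `calibCSS`, ids
`css_n<N>_k<K>`). This file is the KERNEL column of the LOWER half of those cells (existence with the exact parameters):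
for each row the CSS code (type-02 `CSSCode.ofMatrices`, Literature/…/CSS.lean) whose check matrices are the LITERAL gens
rows (`rowMatrix n <bitmasks>`, bit `j` = qubit `j` = character `j` of the gens string «leftmost = qubit 0») is proved
to be EXACTLY `[[n, k, d]]` (`CSSCode.IsCode`: `|Q| = n`, `k = n − rk H^X − rk H^Z`, `cssMinDist = d`) with its two
sector distances `d^X`, `d^Z`, by qec-type-10's distance-certificate checker `DistCert.checkDistCert`
(Census/CertCheck.lean: commutation, weight-`d` logical + non-membership witness, bruteforce replay of every word of
weight `< d` against the allow-list of low-weight stabilizers) and qec-type-02's rank certificates `RankCert.check`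
(Census/RankCert.lean), assembled by `DistCert.isCode_code`; every check is ONE `decide` (≤ 300-word replays) —
tier KERNEL-std, axioms ⊆ {propext, Classical.choice, Quot.sound}, no `native_decide`. The `k = 0` cells (CRSS
convention) and the UPPER half (no CSS `[[n, k, d+1]]`) are separate files. Certificates found and checked in-seat by
qec-type-02's `emit_css_calib.py` from the gens files alone (nothing from the producer is trusted: the kernel
recomputes every syndrome, weight, XOR and parity). HONEST FRAMING: these are statements about the 78 + 12 explicit
instances of the table, not about optimality; coverage of the cell grid is search-5's sentence (CSS-LP upper bounds,
COMPUTED), not claimed here. [folklore] throughout (elementary linear algebra over `𝔽₂`).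
-/

namespace Summit.Ventures.QEC.Census.CSS

open Summit.Ventures.QEC.Census Literature.InformationTheory.QuantumCodes

/-- Census row `css_n7_k1` (family `calibCSS`, CENSUS-PREREG C.2; gens census/search-5/css-n12/css_gens/css_n7_k1.txt, GENS-SHA matrix_sha256 `71062d035df36442…`, file_sha16 `3ae613f0009a165e`; certA `2043f88bdc37ad3b` ∧ certB `570dcd3be1017dad`, ref-1 signed; search-5 provenance: [[7,1,3]] Steane (A=B=[7,3,4] simplex; Steane96)). The CSS code with the LITERAL check rows `H^X = [75, 45, 30]`, `H^Z = [75, 45, 30]` (bitmasks, bit `j` = qubit `j` = character `j` of the gens string) is EXACTLY a `[[7, 1, 3]]` code (`d^X = 3`, `d^Z = 3`): distance certificate (type-10 `DistCert`, bruteforce replay of 56 words) + two rank certificates (type-02 `RankCert`, `r_X = 3`, `r_Z = 3`), all by `decide` — tier KERNEL-std. [folklore] -/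
theorem check_css_n7_k1 :
    ({ n := 7, HX := [75, 45, 30], HZ := [75, 45, 30],
        sideZ := { d := 3, witness := 7, nonmember := 7, found := [] },
        sideX := { d := 3, witness := 7, nonmember := 7, found := [] } } : DistCert).checkDistCert = true := by
  decide

/-- Rank certificate of `H^X` of `css_n7_k1` accepted (`rank = 3`, `decide`). [folklore] -/
theorem rankX_css_n7_k1 : ({ r := 3, pivots := [0, 1, 2], rinv := [11, 10, 9], dependent := [] } : RankCert).check 7 [75, 45, 30] = true := by
  decide

/-- Rank certificate of `H^Z` of `css_n7_k1` accepted (`rank = 3`, `decide`). [folklore] -/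
theorem rankZ_css_n7_k1 : ({ r := 3, pivots := [0, 1, 2], rinv := [11, 10, 9], dependent := [] } : RankCert).check 7 [75, 45, 30] = true := by
  decide

/-- **`css_n7_k1` is a `[[7, 1, 3]]` CSS code** (exact parameters, `CSSCode.IsCode`; KERNEL-std). [folklore] -/
theorem isCode_css_n7_k1 :
    (CSSCode.ofMatrices (rowMatrix 7 [75, 45, 30]) (rowMatrix 7 [75, 45, 30])
      (comm_of_commOK (DistCert.commOK_of_check _ check_css_n7_k1))).IsCode 7 1 3 :=
  DistCert.isCode_code _ check_css_n7_k1 rankX_css_n7_k1 rankZ_css_n7_k1 (by decide)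

/-- `d^X = 3` for `css_n7_k1` (KERNEL-std). [folklore] -/
theorem dX_css_n7_k1 :
    (CSSCode.ofMatrices (rowMatrix 7 [75, 45, 30]) (rowMatrix 7 [75, 45, 30])
      (comm_of_commOK (DistCert.commOK_of_check _ check_css_n7_k1))).dX = 3 :=
  DistCert.dX_code _ check_css_n7_k1

/-- `d^Z = 3` for `css_n7_k1` (KERNEL-std). [folklore] -/
theorem dZ_css_n7_k1 :
    (CSSCode.ofMatrices (rowMatrix 7 [75, 45, 30]) (rowMatrix 7 [75, 45, 30])
      (comm_of_commOK (DistCert.commOK_of_check _ check_css_n7_k1))).dZ = 3 :=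
  DistCert.dZ_code _ check_css_n7_k1

/-- Census row `css_n7_k2` (family `calibCSS`, CENSUS-PREREG C.2; gens census/search-5/css-n12/css_gens/css_n7_k2.txt, GENS-SHA matrix_sha256 `28e8f033fcee6bbc…`, file_sha16 `bda960c8d8707621`; certA `77c28894b9cdb214` ∧ certB `f2f5cdf1b53d1c07`, ref-1 signed; search-5 provenance: sub0(sub0(short_j0X(sub0(sub0([[8,6,2]] A=B=<1^n>)))))). The CSS code with the LITERAL check rows `H^X = [127]`, `H^Z = [65, 43, 17, 5]` (bitmasks, bit `j` = qubit `j` = character `j` of the gens string) is EXACTLY a `[[7, 2, 2]]` code (`d^X = 2`, `d^Z = 2`): distance certificate (type-10 `DistCert`, bruteforce replay of 14 words) + two rank certificates (type-02 `RankCert`, `r_X = 1`, `r_Z = 4`), all by `decide` — tier KERNEL-std. [folklore] -/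
theorem check_css_n7_k2 :
    ({ n := 7, HX := [127], HZ := [65, 43, 17, 5],
        sideZ := { d := 2, witness := 3, nonmember := 10, found := [] },
        sideX := { d := 2, witness := 10, nonmember := 3, found := [] } } : DistCert).checkDistCert = true := by
  decide

/-- Rank certificate of `H^X` of `css_n7_k2` accepted (`rank = 1`, `decide`). [folklore] -/
theorem rankX_css_n7_k2 : ({ r := 1, pivots := [0], rinv := [1], dependent := [] } : RankCert).check 7 [127] = true := by
  decide

/-- Rank certificate of `H^Z` of `css_n7_k2` accepted (`rank = 4`, `decide`). [folklore] -/
theorem rankZ_css_n7_k2 : ({ r := 4, pivots := [0, 1, 2, 3], rinv := [23, 2, 16, 4], dependent := [] } : RankCert).check 7 [65, 43, 17, 5] = true := by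
  decide

/-- **`css_n7_k2` is a `[[7, 2, 2]]` CSS code** (exact parameters, `CSSCode.IsCode`; KERNEL-std). [folklore] -/
theorem isCode_css_n7_k2 :
    (CSSCode.ofMatrices (rowMatrix 7 [127]) (rowMatrix 7 [65, 43, 17, 5])
      (comm_of_commOK (DistCert.commOK_of_check _ check_css_n7_k2))).IsCode 7 2 2 :=
  DistCert.isCode_code _ check_css_n7_k2 rankX_css_n7_k2 rankZ_css_n7_k2 (by decide)

/-- `d^X = 2` for `css_n7_k2` (KERNEL-std). [folklore] -/
theorem dX_css_n7_k2 :
    (CSSCode.ofMatrices (rowMatrix 7 [127]) (rowMatrix 7 [65, 43, 17, 5])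
      (comm_of_commOK (DistCert.commOK_of_check _ check_css_n7_k2))).dX = 2 :=
  DistCert.dX_code _ check_css_n7_k2

/-- `d^Z = 2` for `css_n7_k2` (KERNEL-std). [folklore] -/
theorem dZ_css_n7_k2 :
    (CSSCode.ofMatrices (rowMatrix 7 [127]) (rowMatrix 7 [65, 43, 17, 5])
      (comm_of_commOK (DistCert.commOK_of_check _ check_css_n7_k2))).dZ = 2 :=
  DistCert.dZ_code _ check_css_n7_k2

/-- Census row `css_n7_k3` (family `calibCSS`, CENSUS-PREREG C.2; gens census/search-5/css-n12/css_gens/css_n7_k3.txt, GENS-SHA matrix_sha256 `437ee8685fc3e735…`, file_sha16 `485acbf9425e9e42`; certA `014c6cbe9d305147` ∧ certB `d954e168bedd7008`, ref-1 signed; search-5 provenance: sub0(short_j0X(sub0(sub0([[8,6,2]] A=B=<1^n>))))). The CSS code with the LITERAL check rows `H^X = [127]`, `H^Z = [106, 17, 5]` (bitmasks, bit `j` = qubit `j` = character `j` of the gens string) is EXACTLY a `[[7, 3, 2]]` code (`d^X = 2`, `d^Z = 2`): distance certificate (type-10 `DistCert`, bruteforce replay of 14 words) + two rank certificates (type-02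 `RankCert`, `r_X = 1`, `r_Z = 3`), all by `decide` — tier KERNEL-std. [folklore] -/
theorem check_css_n7_k3 :
    ({ n := 7, HX := [127], HZ := [106, 17, 5],
        sideZ := { d := 2, witness := 3, nonmember := 10, found := [] },
        sideX := { d := 2, witness := 10, nonmember := 3, found := [] } } : DistCert).checkDistCert = true := by
  decide

/-- Rank certificate of `H^X` of `css_n7_k3` accepted (`rank = 1`, `decide`). [folklore] -/
theorem rankX_css_n7_k3 : ({ r := 1, pivots := [0], rinv := [1], dependent := [] } : RankCert).check 7 [127] = true := by
  decide

/-- Rank certificate of `H^Z` of `css_n7_k3` accepted (`rank = 3`, `decide`). [folklore] -/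
theorem rankZ_css_n7_k3 : ({ r := 3, pivots := [0, 1, 2], rinv := [2, 5, 4], dependent := [] } : RankCert).check 7 [106, 17, 5] = true := by
  decide

/-- **`css_n7_k3` is a `[[7, 3, 2]]` CSS code** (exact parameters, `CSSCode.IsCode`; KERNEL-std). [folklore] -/
theorem isCode_css_n7_k3 :
    (CSSCode.ofMatrices (rowMatrix 7 [127]) (rowMatrix 7 [106, 17, 5])
      (comm_of_commOK (DistCert.commOK_of_check _ check_css_n7_k3))).IsCode 7 3 2 :=
  DistCert.isCode_code _ check_css_n7_k3 rankX_css_n7_k3 rankZ_css_n7_k3 (by decide)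

/-- `d^X = 2` for `css_n7_k3` (KERNEL-std). [folklore] -/
theorem dX_css_n7_k3 :
    (CSSCode.ofMatrices (rowMatrix 7 [127]) (rowMatrix 7 [106, 17, 5])
      (comm_of_commOK (DistCert.commOK_of_check _ check_css_n7_k3))).dX = 2 :=
  DistCert.dX_code _ check_css_n7_k3

/-- `d^Z = 2` for `css_n7_k3` (KERNEL-std). [folklore] -/
theorem dZ_css_n7_k3 :
    (CSSCode.ofMatrices (rowMatrix 7 [127]) (rowMatrix 7 [106, 17, 5])
      (comm_of_commOK (DistCert.commOK_of_check _ check_css_n7_k3))).dZ = 2 :=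
  DistCert.dZ_code _ check_css_n7_k3

/-- Census row `css_n7_k4` (family `calibCSS`, CENSUS-PREREG C.2; gens census/search-5/css-n12/css_gens/css_n7_k4.txt, GENS-SHA matrix_sha256 `7225d0445190b388…`, file_sha16 `3ea50bbc296de41a`; certA `ebf5fcb42e962113` ∧ certB `cc5ca2314625fb54`, ref-1 signed; search-5 provenance: short_j0X(sub0(sub0([[8,6,2]] A=B=<1^n>)))). The CSS code with the LITERAL check rows `H^X = [127]`, `H^Z = [123, 5]` (bitmasks, bit `j` = qubit `j` = character `j` of the gens string) is EXACTLY a `[[7, 4, 2]]` code (`d^X = 2`, `d^Z = 2`): distance certificate (type-10 `DistCert`, bruteforce replay of 14 words) + two rank certificates (type-02 `RankCert`, `r_X = 1`, `r_Z = 2`), all by `decide` — tier KERNEL-std. [folklore] -/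
theorem check_css_n7_k4 :
    ({ n := 7, HX := [127], HZ := [123, 5],
        sideZ := { d := 2, witness := 3, nonmember := 10, found := [] },
        sideX := { d := 2, witness := 10, nonmember := 3, found := [] } } : DistCert).checkDistCert = true := by
  decide

/-- Rank certificate of `H^X` of `css_n7_k4` accepted (`rank = 1`, `decide`). [folklore] -/
theorem rankX_css_n7_k4 : ({ r := 1, pivots := [0], rinv := [1], dependent := [] } : RankCert).check 7 [127] = true := by
  decide

/-- Rank certificate of `H^Z` of `css_n7_k4` accepted (`rank = 2`, `decide`). [folklore] -/
theorem rankZ_css_n7_k4 : ({ r := 2, pivots := [0, 1], rinv := [2, 3], dependent := [] } : RankCert).check 7 [123, 5] = true := by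
  decide

/-- **`css_n7_k4` is a `[[7, 4, 2]]` CSS code** (exact parameters, `CSSCode.IsCode`; KERNEL-std). [folklore] -/
theorem isCode_css_n7_k4 :
    (CSSCode.ofMatrices (rowMatrix 7 [127]) (rowMatrix 7 [123, 5])
      (comm_of_commOK (DistCert.commOK_of_check _ check_css_n7_k4))).IsCode 7 4 2 :=
  DistCert.isCode_code _ check_css_n7_k4 rankX_css_n7_k4 rankZ_css_n7_k4 (by decide)

/-- `d^X = 2` for `css_n7_k4` (KERNEL-std). [folklore] -/
theorem dX_css_n7_k4 :
    (CSSCode.ofMatrices (rowMatrix 7 [127]) (rowMatrix 7 [123, 5])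
      (comm_of_commOK (DistCert.commOK_of_check _ check_css_n7_k4))).dX = 2 :=
  DistCert.dX_code _ check_css_n7_k4

/-- `d^Z = 2` for `css_n7_k4` (KERNEL-std). [folklore] -/
theorem dZ_css_n7_k4 :
    (CSSCode.ofMatrices (rowMatrix 7 [127]) (rowMatrix 7 [123, 5])
      (comm_of_commOK (DistCert.commOK_of_check _ check_css_n7_k4))).dZ = 2 :=
  DistCert.dZ_code _ check_css_n7_k4

/-- Census row `css_n7_k5` (family `calibCSS`, CENSUS-PREREG C.2; gens census/search-5/css-n12/css_gens/css_n7_k5.txt, GENS-SHA matrix_sha256 `d753acc4d8cf28ad…`, file_sha16 `f2ada5ed3b73b70d`; certA `49f93c9e43857112` ∧ certB `8b5f16d72f246657`, ref-1 signed; search-5 provenance: trivial CSS [[7,5,1]]). The CSS code with the LITERAL check rows `H^X = []`, `H^Z = [2, 1]` (bitmasks, bit `j` = qubit `j` = character `j` of the gens string) is EXACTLY a `[[7, 5, 1]]` code (`d^X = 1`, `d^Z = 1`): distance certificate (type-10 `DistCert`, bruteforce replay of 0 words) + two rank certificates (type-02 `RankCert`, `r_X = 0`, `r_Z = 2`), all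 by `decide` — tier KERNEL-std. [folklore] -/
theorem check_css_n7_k5 :
    ({ n := 7, HX := [], HZ := [2, 1],
        sideZ := { d := 1, witness := 4, nonmember := 4, found := [] },
        sideX := { d := 1, witness := 4, nonmember := 4, found := [] } } : DistCert).checkDistCert = true := by
  decide

/-- Rank certificate of `H^X` of `css_n7_k5` accepted (`rank = 0`, `decide`). [folklore] -/
theorem rankX_css_n7_k5 : ({ r := 0, pivots := [], rinv := [], dependent := [] } : RankCert).check 7 [] = true := by
  decide

/-- Rank certificate of `H^Z` of `css_n7_k5` accepted (`rank = 2`, `decide`). [folklore] -/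
theorem rankZ_css_n7_k5 : ({ r := 2, pivots := [0, 1], rinv := [2, 1], dependent := [] } : RankCert).check 7 [2, 1] = true := by
  decide

/-- **`css_n7_k5` is a `[[7, 5, 1]]` CSS code** (exact parameters, `CSSCode.IsCode`; KERNEL-std). [folklore] -/
theorem isCode_css_n7_k5 :
    (CSSCode.ofMatrices (rowMatrix 7 []) (rowMatrix 7 [2, 1])
      (comm_of_commOK (DistCert.commOK_of_check _ check_css_n7_k5))).IsCode 7 5 1 :=
  DistCert.isCode_code _ check_css_n7_k5 rankX_css_n7_k5 rankZ_css_n7_k5 (by decide)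

/-- `d^X = 1` for `css_n7_k5` (KERNEL-std). [folklore] -/
theorem dX_css_n7_k5 :
    (CSSCode.ofMatrices (rowMatrix 7 []) (rowMatrix 7 [2, 1])
      (comm_of_commOK (DistCert.commOK_of_check _ check_css_n7_k5))).dX = 1 :=
  DistCert.dX_code _ check_css_n7_k5

/-- `d^Z = 1` for `css_n7_k5` (KERNEL-std). [folklore] -/
theorem dZ_css_n7_k5 :
    (CSSCode.ofMatrices (rowMatrix 7 []) (rowMatrix 7 [2, 1])
      (comm_of_commOK (DistCert.commOK_of_check _ check_css_n7_k5))).dZ = 1 :=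
  DistCert.dZ_code _ check_css_n7_k5

/-- Census row `css_n7_k6` (family `calibCSS`, CENSUS-PREREG C.2; gens census/search-5/css-n12/css_gens/css_n7_k6.txt, GENS-SHA matrix_sha256 `9a460c1e90af3a96…`, file_sha16 `0b6d10019b1d9826`; certA `f71cc6cde2acb2e4` ∧ certB `c3822017143ccccc`, ref-1 signed; search-5 provenance: trivial CSS [[7,6,1]]). The CSS code with the LITERAL check rows `H^X = []`, `H^Z = [1]` (bitmasks, bit `j` = qubit `j` = character `j` of the gens string) is EXACTLY a `[[7, 6, 1]]` code (`d^X = 1`, `d^Z = 1`): distance certificate (type-10 `DistCert`, bruteforce replay of 0 words) + two rank certificates (type-02 `RankCert`, `r_X = 0`, `r_Z = 1`), all by `decide` — tier KERNEL-std. [folklore] -/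
theorem check_css_n7_k6 :
    ({ n := 7, HX := [], HZ := [1],
        sideZ := { d := 1, witness := 2, nonmember := 2, found := [] },
        sideX := { d := 1, witness := 2, nonmember := 2, found := [] } } : DistCert).checkDistCert = true := by
  decide

/-- Rank certificate of `H^X` of `css_n7_k6` accepted (`rank = 0`, `decide`). [folklore] -/
theorem rankX_css_n7_k6 : ({ r := 0, pivots := [], rinv := [], dependent := [] } : RankCert).check 7 [] = true := by
  decide

/-- Rank certificate of `H^Z` of `css_n7_k6` accepted (`rank = 1`, `decide`). [folklore] -/
theorem rankZ_css_n7_k6 : ({ r := 1, pivots := [0], rinv := [1], dependent := [] } : RankCert).check 7 [1] = true := by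
  decide

/-- **`css_n7_k6` is a `[[7, 6, 1]]` CSS code** (exact parameters, `CSSCode.IsCode`; KERNEL-std). [folklore] -/
theorem isCode_css_n7_k6 :
    (CSSCode.ofMatrices (rowMatrix 7 []) (rowMatrix 7 [1])
      (comm_of_commOK (DistCert.commOK_of_check _ check_css_n7_k6))).IsCode 7 6 1 :=
  DistCert.isCode_code _ check_css_n7_k6 rankX_css_n7_k6 rankZ_css_n7_k6 (by decide)

/-- `d^X = 1` for `css_n7_k6` (KERNEL-std). [folklore] -/
theorem dX_css_n7_k6 :
    (CSSCode.ofMatrices (rowMatrix 7 []) (rowMatrix 7 [1])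
      (comm_of_commOK (DistCert.commOK_of_check _ check_css_n7_k6))).dX = 1 :=
  DistCert.dX_code _ check_css_n7_k6

/-- `d^Z = 1` for `css_n7_k6` (KERNEL-std). [folklore] -/
theorem dZ_css_n7_k6 :
    (CSSCode.ofMatrices (rowMatrix 7 []) (rowMatrix 7 [1])
      (comm_of_commOK (DistCert.commOK_of_check _ check_css_n7_k6))).dZ = 1 :=
  DistCert.dZ_code _ check_css_n7_k6

/-- Census row `css_n7_k7` (family `calibCSS`, CENSUS-PREREG C.2; gens census/search-5/css-n12/css_gens/css_n7_k7.txt, GENS-SHA matrix_sha256 `d7267d306bb7cebf…`, file_sha16 `a6fa994437d9804e`; certA `9e5cab6b98a306fd` ∧ certB `7412f0bb1b08572e`, ref-1 signed; search-5 provenance: trivial CSS [[7,7,1]]). The CSS code with the LITERAL check rows `H^X = []`, `H^Z = []` (bitmasks, bit `j` = qubit `j` = character `j` of the gens string) is EXACTLY a `[[7, 7, 1]]` code (`d^X = 1`, `d^Z = 1`): distance certificate (type-10 `DistCert`, bruteforce replay of 0 words) + two rank certificates (type-02 `RankCert`, `r_X = 0`, `r_Z = 0`), all by `decide` — tier KERNEL-std.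 [folklore] -/
theorem check_css_n7_k7 :
    ({ n := 7, HX := [], HZ := [],
        sideZ := { d := 1, witness := 1, nonmember := 1, found := [] },
        sideX := { d := 1, witness := 1, nonmember := 1, found := [] } } : DistCert).checkDistCert = true := by
  decide

/-- Rank certificate of `H^X` of `css_n7_k7` accepted (`rank = 0`, `decide`). [folklore] -/
theorem rankX_css_n7_k7 : ({ r := 0, pivots := [], rinv := [], dependent := [] } : RankCert).check 7 [] = true := by
  decide

/-- Rank certificate of `H^Z` of `css_n7_k7` accepted (`rank = 0`, `decide`). [folklore] -/
theorem rankZ_css_n7_k7 : ({ r := 0, pivots := [], rinv := [], dependent := [] } : RankCert).check 7 [] = true := by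
  decide

/-- **`css_n7_k7` is a `[[7, 7, 1]]` CSS code** (exact parameters, `CSSCode.IsCode`; KERNEL-std). [folklore] -/
theorem isCode_css_n7_k7 :
    (CSSCode.ofMatrices (rowMatrix 7 []) (rowMatrix 7 [])
      (comm_of_commOK (DistCert.commOK_of_check _ check_css_n7_k7))).IsCode 7 7 1 :=
  DistCert.isCode_code _ check_css_n7_k7 rankX_css_n7_k7 rankZ_css_n7_k7 (by decide)

/-- `d^X = 1` for `css_n7_k7` (KERNEL-std). [folklore] -/
theorem dX_css_n7_k7 :
    (CSSCode.ofMatrices (rowMatrix 7 []) (rowMatrix 7 [])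
      (comm_of_commOK (DistCert.commOK_of_check _ check_css_n7_k7))).dX = 1 :=
  DistCert.dX_code _ check_css_n7_k7

/-- `d^Z = 1` for `css_n7_k7` (KERNEL-std). [folklore] -/
theorem dZ_css_n7_k7 :
    (CSSCode.ofMatrices (rowMatrix 7 []) (rowMatrix 7 [])
      (comm_of_commOK (DistCert.commOK_of_check _ check_css_n7_k7))).dZ = 1 :=
  DistCert.dZ_code _ check_css_n7_k7

end Summit.Ventures.QEC.Census.CSS
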